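import Summits.ValiantsHypothesis.ValiantsHypothesis.Theorems.MonotoneRestorationOrbitRestorationQPSmallModulesAltSpanning
import Summits.ValiantsHypothesis.ValiantsHypothesis.Theorems.MonotoneRestorationOrbitRestorationQPRowColumnRestorable
import HarnessLib

/-!
# Route MonotoneRestoration — crux `OrbitRestorationQP` (stmt-ValiantsHypothesis-18293), line `depth_three_rung`:
# the symmetric-model sub-rung of `A_∞` — FRAMES WITH INVARIANT MOMENTS RESTORE (unconditionally)

Helper file (`--supports stmt-ValiantsHypothesis-18293`), def-free.  Namespace
`Summit.ValiantsHypothesis.ValiantsHypothesis.Theorems.OrbitRestorationQPDepthThreeRung.SymmetricModel` (continued from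
`Theorems/MonotoneRestorationOrbitRestorationQPSymmetricModel.lean`: Shpilka's symmetric model `a · e_d(Y)`, `Y` an affine
frame of `≤ n^c + c` forms, typed as a sub-rung between A₁ and A_∞; tame = matrix-stable frames restore by kind (S)).

This file proves the rung on a much larger class of frames — those whose first `d` MOMENTS (power sums)
`p_j(Y) = Σ_{y ∈ Y} y^j`, `1 ≤ j ≤ d`, are matrix-symmetric — with NO stability assumption on the frame itself:

* `esymm_mem_adjoin_psum_le` — BOUNDED NEWTON: `e_k ∈ ℂ[p_1, …, p_d]` for `k ≤ d` (Mathlib's `MvPolynomial.mul_esymm_eq_sum`,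
  strong induction; only the power sums of order `≤ d` are used);
* `esymm_frame_mem_adjoin_moments` — transported to a frame `v : Fin m → ℂ[x]`: `e_k(v) ∈ ℂ[p_1(v), …, p_d(v)]`, `k ≤ d`;
* `qpOrbitRestorable_moment` — each matrix-symmetric moment `p_j(Y)` of an affine frame of `≤ n^c + c` forms is
  `QPOrbitRestorable K n` with `K` depending on `c` only (the landed UNCONDITIONAL ΣΛΣ rung at one level,
  `DerivativeTower.sigmaLambdaSigma_affine_restorable_of_smallModulesAltSupported` fed by `AltFix.smallModules_altSpanning`,
  and `Restorable.qpOrbitRestorable_of_invariant` below its threshold);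
* ★ `qpOrbitRestorable_esymm_of_invariantMoments` — **FRAMES WITH INVARIANT MOMENTS RESTORE**: for every `c` there is
  `c'` such that for every level `n`, every affine frame `Y = (ℓ_{w_i} + b_i)_{i<m}`, `m ≤ n^c + c`, whose moments
  `p_1(Y), …, p_d(Y)` are matrix-symmetric, and every `a`, the polynomial `a · e_d(Y)` is `QPOrbitRestorable c' n`
  (polynomial expressions in restorable values restore at flat cost, `RowColumnRestorable.qpOrbitRestorable_of_mem_adjoin`);
* `symmetricModel_of_invariantMoments` — the family form.

Why this is the right cut of the new rung.  `e_1(Y), …, e_d(Y)` are all invariant iff `p_1(Y), …, p_d(Y)` are (Newton both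
ways), iff the generating polynomial `Π_y (1 + t y)` is invariant MODULO `t^{d+1}`; matrix-STABLE frames are the case
`t^∞` (then the multiset itself is permuted, by unique factorisation).  So the moment class strictly contains the tame class
(e.g. any frame `Y ⊔ W` with `Y` stable and `W` a wild frame that is NULL to order `d`, `e_1(W) = ⋯ = e_d(W) = 0`, such as
`r > d` rotations `{ω^j w}` of an arbitrary form), needs no identifiability and no bound on `d`, and leaves as the residue
of the symmetric-model rung exactly the frames with `e_d(Y)` invariant but some lower moment NOT invariant — cancellation
between the graded pieces of ONE coefficient of `Π_y (1 + t y)`.  Honest label: a sub-rung theorem; no registered stub is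
closed; A_∞, the crux and VP ≠ VNP are NOT moved.

v2 (appended): TRUNCATED-STABLE FRAMES — `psum_mem_adjoin_esymm_le` (bounded inverse Newton `p_k ∈ ℂ[e_1, …, e_d]`,
`k ≤ d`), `rename_eq_of_mem_adjoin` (subalgebras generated by invariants are invariant), `moments_invariant_of_esymm_invariant`,
★ `qpOrbitRestorable_esymm_of_invariantTruncation`: if `e_1(Y), …, e_d(Y)` are matrix-symmetric — i.e. `Π_y (1 + t y)` is
invariant modulo `t^{d+1}` — then `a · e_d(Y)` is `QPOrbitRestorable c' n` (same uniform `c'`).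

## References
* A. Shpilka, *Affine projections of symmetric polynomials*, J. Comput. System Sci. 65 (2002) 639–659, Thm 3.1, §5
  (Newton's identities in the symmetric model). [Shpilka2002]
* A. Dawar, G. Wilsenach, *Symmetric arithmetic circuits*, ToC 21 (2025), §3.3 (ORB). [DawarWilsenach2025]
-/

noncomputable section

open scoped Classical

-- `Summit.ValiantsHypothesis.ValiantsHypothesis.…` is the tree's single-conjunct layout (Sub = Summit).
set_option linter.dupNamespace false

namespace Summit.ValiantsHypothesis.ValiantsHypothesis.Theorems

namespace OrbitRestorationQPDepthThreeRung

namespace SymmetricModel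

open MvPolynomial Finset Equiv WaringJennrich LevelStructure ProductAction

variable {n : ℕ}

/-! ### Bounded Newton identities -/

/-- **BOUNDED NEWTON.**  For `k ≤ d`, the elementary symmetric polynomial `e_k` in `m` variables lies in the subalgebra
generated by the power sums `p_1, …, p_d` (only moments of order `≤ d` are needed). [folklore; cite: Shpilka2002, §5] -/
theorem esymm_mem_adjoin_psum_le (m d : ℕ) {k : ℕ} (hk : k ≤ d) :
    esymm (Fin m) ℂ k ∈ Algebra.adjoin ℂ (Set.range fun j : Fin d => psum (Fin m) ℂ ((j : ℕ) + 1)) := by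
  induction k using Nat.strong_induction_on with
  | _ k ih =>
    rcases Nat.eq_zero_or_pos k with rfl | hpos
    · rw [esymm_zero]
      exact Subalgebra.one_mem _
    have hk0 : (k : ℂ) ≠ 0 := Nat.cast_ne_zero.mpr hpos.ne'
    have key := MvPolynomial.mul_esymm_eq_sum (Fin m) ℂ k
    have hCk : esymm (Fin m) ℂ k = (k : ℂ)⁻¹ • ((k : MvPolynomial (Fin m) ℂ) * esymm (Fin m) ℂ k) := by
      rw [smul_eq_C_mul, ← mul_assoc, show (k : MvPolynomial (Fin m) ℂ) = C (k : ℂ) from (map_natCast C k).symm,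
        ← map_mul, inv_mul_cancel₀ hk0, C_1, one_mul]
    have hneg : ∀ i : ℕ, (-1 : MvPolynomial (Fin m) ℂ) ^ i ∈
        Algebra.adjoin ℂ (Set.range fun j : Fin d => psum (Fin m) ℂ ((j : ℕ) + 1)) := fun i =>
      Subalgebra.pow_mem _ (Subalgebra.neg_mem _ (Subalgebra.one_mem _)) _
    rw [hCk, key]
    refine Subalgebra.smul_mem _ (Subalgebra.mul_mem _ (hneg _) (Subalgebra.sum_mem _ fun a ha => ?_)) _
    rw [Finset.mem_filter, Finset.HasAntidiagonal.mem_antidiagonal] at ha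
    obtain ⟨hab, halt⟩ := ha
    refine Subalgebra.mul_mem _ (Subalgebra.mul_mem _ (hneg _) (ih a.1 halt (by omega))) ?_
    have ha1 : 1 ≤ a.2 := by omega
    have ha2 : a.2 - 1 < d := by omega
    refine Algebra.subset_adjoin ⟨⟨a.2 - 1, ha2⟩, ?_⟩
    simp only [Nat.sub_add_cancel ha1]

/-- **Bounded Newton on a frame**: for a family `v : Fin m → ℂ[x]` and `k ≤ d`, `e_k(v_0, …, v_{m-1})` lies in the
subalgebra generated by the moments `Σ_i v_i^j`, `1 ≤ j ≤ d`. [folklore; cite: Shpilka2002, §5] -/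
theorem esymm_frame_mem_adjoin_moments {m : ℕ} (v : Fin m → MvPolynomial (Fin n × Fin n) ℂ) {k d : ℕ}
    (hk : k ≤ d) :
    ((univ : Finset (Fin m)).val.map v).esymm k ∈
      Algebra.adjoin ℂ (Set.range fun j : Fin d => ∑ i : Fin m, v i ^ ((j : ℕ) + 1)) := by
  have h2 : aeval v (esymm (Fin m) ℂ k) ∈
      (Algebra.adjoin ℂ (Set.range fun j : Fin d => psum (Fin m) ℂ ((j : ℕ) + 1))).map (aeval v) :=
    Subalgebra.mem_map.2 ⟨_, esymm_mem_adjoin_psum_le m d hk, rfl⟩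
  rw [AlgHom.map_adjoin, ← Set.range_comp, MvPolynomial.aeval_esymm_eq_multiset_esymm] at h2
  have hfun : ((aeval v : MvPolynomial (Fin m) ℂ →ₐ[ℂ] MvPolynomial (Fin n × Fin n) ℂ) ∘
      fun j : Fin d => psum (Fin m) ℂ ((j : ℕ) + 1)) = fun j : Fin d => ∑ i : Fin m, v i ^ ((j : ℕ) + 1) := by
    funext j
    simp only [Function.comp_apply, psum, map_sum, map_pow, aeval_X]
  rwa [hfun] at h2

/-! ### Invariant moments restore (the ΣΛΣ rung at one level) -/

/-- **A matrix-symmetric moment of an affine frame restores, uniformly.**  For every `c` there is `K` such that at every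
level `n`, for every affine frame `(ℓ_{w_i} + b_i)_{i<m}` with `m ≤ n^c + c` and every `j`, if the moment
`p_j = Σ_i (ℓ_{w_i} + b_i)^j` is matrix-symmetric then it is `QPOrbitRestorable K n` — the landed unconditional ΣΛΣ rung,
run at one level (all Waring coefficients `1`), with the invariant fallback below its threshold. [folklore] -/
theorem qpOrbitRestorable_moment (c : ℕ) : ∃ K : ℕ, ∀ (n m : ℕ) (w : Fin m → (Fin n × Fin n) → ℂ) (b : Fin m → ℂ)
    (j : ℕ), m ≤ n ^ c + c →
    (∀ σ τ : Perm (Fin n), rename (fun q : Fin n × Fin n => (σ q.1, τ q.2)) (∑ i, (lin (w i) + C (b i)) ^ j) =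
      ∑ i, (lin (w i) + C (b i)) ^ j) →
    QPOrbitRestorable K n (∑ i, (lin (w i) + C (b i)) ^ j) := by
  obtain ⟨k, n₀, hk⟩ := AltFix.smallModules_altSpanning c
  refine ⟨max (k + 7) (n₀.factorial + 5), fun n m w b j hm hsym => ?_⟩
  have hsym' : ∀ σ τ : Perm (Fin n), mact σ τ (∑ i, (lin (w i) + C (b i)) ^ j) = ∑ i, (lin (w i) + C (b i)) ^ j := by
    intro σ τ
    rw [mact_apply]
    exact hsym σ τ
  by_cases hn : n₀ ≤ n
  · refine Restorable.qpOrbitRestorable_mono (le_max_left _ _) ?_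
    refine DerivativeTower.sigmaLambdaSigma_affine_restorable_of_smallModulesAltSupported (k := k) (r := m)
      (d := j) ?_ w b (fun _ => 1) ?_ hsym'
    · intro W hW hdim hst
      exact hk n hn W hW (hdim.trans hm) fun ρ w' hw' => by rw [ren_eq_mact]; exact hst ρ ρ w' hw'
    · simp only [map_one, one_mul]
  · refine Restorable.qpOrbitRestorable_mono ?_ (Restorable.qpOrbitRestorable_of_invariant _ fun σ => ?_)
    · have h1 : n.factorial ≤ n₀.factorial := Nat.factorial_le (by omega)
      exact (Nat.add_le_add_right h1 5).trans (le_max_right _ _)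
    · rw [ren_eq_mact]
      exact hsym' σ σ

/-! ### Frames with invariant moments restore -/

/-- ★ **FRAMES WITH INVARIANT MOMENTS RESTORE (unconditionally, uniform constant).**  For every `c` there is `c'` such
that at every level `n`, for every affine frame `Y = (ℓ_{w_i} + b_i)_{i<m}` with `m ≤ n^c + c` whose moments
`p_j(Y) = Σ_i (ℓ_{w_i} + b_i)^j` are matrix-symmetric for `1 ≤ j ≤ d`, and every scalar `a`, the symmetric-model polynomial
`a · e_d(Y)` is `QPOrbitRestorable c' n`.  (Bounded Newton puts `e_d(Y)` in `ℂ[p_1(Y), …, p_d(Y)]`; each moment restores by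
the ΣΛΣ rung; polynomial expressions in restorable values restore at flat cost `+3`.)  No stability of the frame, no
identifiability, no bound on `d`. [folklore; cite: Shpilka2002, Thm 3.1] -/
theorem qpOrbitRestorable_esymm_of_invariantMoments (c : ℕ) : ∃ c' : ℕ, ∀ (n m : ℕ)
    (w : Fin m → (Fin n × Fin n) → ℂ) (b : Fin m → ℂ) (a : ℂ) (d : ℕ), m ≤ n ^ c + c →
    (∀ j : ℕ, 1 ≤ j → j ≤ d → ∀ σ τ : Perm (Fin n),
      rename (fun q : Fin n × Fin n => (σ q.1, τ q.2)) (∑ i, (lin (w i) + C (b i)) ^ j) =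
        ∑ i, (lin (w i) + C (b i)) ^ j) →
    QPOrbitRestorable c' n
      (C a * (((univ : Finset (Fin m)).val.map fun i => lin (w i) + C (b i)).esymm d)) := by
  obtain ⟨K, hK⟩ := qpOrbitRestorable_moment c
  refine ⟨K + 3, fun n m w b a d hm hmom => ?_⟩
  have hT : ∀ t ∈ Set.range (fun j : Fin d => ∑ i : Fin m, (lin (w i) + C (b i)) ^ ((j : ℕ) + 1)),
      QPOrbitRestorable K n t := by
    rintro t ⟨j, rfl⟩
    exact hK n m w b ((j : ℕ) + 1) hm (hmom ((j : ℕ) + 1) (by omega) (Nat.succ_le_of_lt j.isLt))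
  have hmem : C a * (((univ : Finset (Fin m)).val.map fun i => lin (w i) + C (b i)).esymm d) ∈
      Algebra.adjoin ℂ (Set.range fun j : Fin d => ∑ i : Fin m, (lin (w i) + C (b i)) ^ ((j : ℕ) + 1)) :=
    Subalgebra.mul_mem _ (Subalgebra.algebraMap_mem _ _)
      (esymm_frame_mem_adjoin_moments (fun i => lin (w i) + C (b i)) le_rfl)
  exact RowColumnRestorable.qpOrbitRestorable_of_mem_adjoin hT hmem

/-- **THE SYMMETRIC-MODEL RUNG HOLDS ON FRAMES WITH INVARIANT MOMENTS (family form).**  Every family given at every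
level as `a · e_d(Y)` for an affine frame `Y` of `≤ n^c + c` forms whose first `d` moments are matrix-symmetric is
quasi-polynomially orbit-restorable — unconditionally. [folklore; cite: Shpilka2002, Thm 3.1] -/
theorem symmetricModel_of_invariantMoments :
    ∀ f : (n : ℕ) → MvPolynomial (Fin n × Fin n) ℂ,
      (∃ c : ℕ, ∀ n : ℕ, ∃ (m : ℕ) (w : Fin m → (Fin n × Fin n) → ℂ) (b : Fin m → ℂ) (a : ℂ) (d : ℕ),
        m ≤ n ^ c + c ∧
        (∀ j : ℕ, 1 ≤ j → j ≤ d → ∀ σ τ : Perm (Fin n),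
          rename (fun q : Fin n × Fin n => (σ q.1, τ q.2)) (∑ i, (lin (w i) + C (b i)) ^ j) =
            ∑ i, (lin (w i) + C (b i)) ^ j) ∧
        f n = C a * (((univ : Finset (Fin m)).val.map fun i => lin (w i) + C (b i)).esymm d)) →
      ∃ c : ℕ, ∀ n : ℕ, QPOrbitRestorable c n (f n) := by
  intro f hf
  obtain ⟨c, hc⟩ := hf
  obtain ⟨c', hc'⟩ := qpOrbitRestorable_esymm_of_invariantMoments c
  refine ⟨c', fun n => ?_⟩
  obtain ⟨m, w, b, a, d, hm, hmom, hfn⟩ := hc n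
  rw [hfn]
  exact hc' n m w b a d hm hmom

/-! ### v2 — Truncated-stable frames: invariant `e_1(Y), …, e_d(Y)` -/

/-- **BOUNDED INVERSE NEWTON.**  For `k ≤ d`, the power sum `p_k` in `m` variables lies in the subalgebra generated by
`e_1, …, e_d` (Mathlib's `MvPolynomial.psum_eq_mul_esymm_sub_sum`, strong induction). [folklore; cite: Shpilka2002, §5] -/
theorem psum_mem_adjoin_esymm_le (m d : ℕ) {k : ℕ} (hk : k ≤ d) :
    psum (Fin m) ℂ k ∈ Algebra.adjoin ℂ (Set.range fun j : Fin d => esymm (Fin m) ℂ ((j : ℕ) + 1)) := by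
  induction k using Nat.strong_induction_on with
  | _ k ih =>
    rcases Nat.eq_zero_or_pos k with rfl | hpos
    · simp only [psum, pow_zero]
      exact Subalgebra.sum_mem _ fun _ _ => Subalgebra.one_mem _
    have hneg : ∀ i : ℕ, (-1 : MvPolynomial (Fin m) ℂ) ^ i ∈
        Algebra.adjoin ℂ (Set.range fun j : Fin d => esymm (Fin m) ℂ ((j : ℕ) + 1)) := fun i =>
      Subalgebra.pow_mem _ (Subalgebra.neg_mem _ (Subalgebra.one_mem _)) _
    have hes : ∀ i : ℕ, 1 ≤ i → i ≤ d →
        esymm (Fin m) ℂ i ∈ Algebra.adjoin ℂ (Set.range fun j : Fin d => esymm (Fin m) ℂ ((j : ℕ) + 1)) := by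
      intro i h1 h2
      refine Algebra.subset_adjoin ⟨⟨i - 1, by omega⟩, ?_⟩
      simp only [Nat.sub_add_cancel h1]
    rw [MvPolynomial.psum_eq_mul_esymm_sub_sum (Fin m) ℂ k hpos]
    refine Subalgebra.sub_mem _
      (Subalgebra.mul_mem _ (Subalgebra.mul_mem _ (hneg _) (natCast_mem _ k)) (hes k hpos (by omega)))
      (Subalgebra.sum_mem _ fun a ha => ?_)
    rw [Finset.mem_filter, Finset.HasAntidiagonal.mem_antidiagonal, Set.mem_Ioo] at ha
    obtain ⟨hab, h0a, hak⟩ := ha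
    exact Subalgebra.mul_mem _ (Subalgebra.mul_mem _ (hneg _) (hes a.1 h0a (by omega)))
      (ih a.2 (by omega) (by omega))

/-- **Bounded inverse Newton on a frame**: the moments `Σ_i v_i^k`, `k ≤ d`, lie in the subalgebra generated by
`e_1(v), …, e_d(v)`. [folklore; cite: Shpilka2002, §5] -/
theorem moment_mem_adjoin_esymm {m : ℕ} (v : Fin m → MvPolynomial (Fin n × Fin n) ℂ) {k d : ℕ} (hk : k ≤ d) :
    ∑ i : Fin m, v i ^ k ∈
      Algebra.adjoin ℂ (Set.range fun j : Fin d => ((univ : Finset (Fin m)).val.map v).esymm ((j : ℕ) + 1)) := by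
  have h2 : aeval v (psum (Fin m) ℂ k) ∈
      (Algebra.adjoin ℂ (Set.range fun j : Fin d => esymm (Fin m) ℂ ((j : ℕ) + 1))).map (aeval v) :=
    Subalgebra.mem_map.2 ⟨_, psum_mem_adjoin_esymm_le m d hk, rfl⟩
  rw [AlgHom.map_adjoin, ← Set.range_comp] at h2
  have hfun : ((aeval v : MvPolynomial (Fin m) ℂ →ₐ[ℂ] MvPolynomial (Fin n × Fin n) ℂ) ∘
      fun j : Fin d => esymm (Fin m) ℂ ((j : ℕ) + 1)) =
        fun j : Fin d => ((univ : Finset (Fin m)).val.map v).esymm ((j : ℕ) + 1) := by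
    funext j
    simp only [Function.comp_apply, MvPolynomial.aeval_esymm_eq_multiset_esymm]
  have hps : aeval v (psum (Fin m) ℂ k) = ∑ i : Fin m, v i ^ k := by
    simp only [psum, map_sum, map_pow, aeval_X]
  rwa [hfun, hps] at h2

/-- A subalgebra generated by polynomials fixed by an algebra endomorphism is fixed by it. [folklore] -/
theorem eq_of_mem_adjoin_of_forall_eq (φ : MvPolynomial (Fin n × Fin n) ℂ →ₐ[ℂ] MvPolynomial (Fin n × Fin n) ℂ)
    {T : Set (MvPolynomial (Fin n × Fin n) ℂ)} (hT : ∀ t ∈ T, φ t = t)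
    {p : MvPolynomial (Fin n × Fin n) ℂ} (hp : p ∈ Algebra.adjoin ℂ T) : φ p = p := by
  have hle : Algebra.adjoin ℂ T ≤ AlgHom.equalizer φ (AlgHom.id ℂ _) :=
    Algebra.adjoin_le fun t ht => by rw [SetLike.mem_coe, AlgHom.mem_equalizer, AlgHom.id_apply]; exact hT t ht
  have h := hle hp
  rw [AlgHom.mem_equalizer, AlgHom.id_apply] at h
  exact h

/-- **Invariant elementary symmetric polynomials give invariant moments**: if `e_1(Y), …, e_d(Y)` are matrix-symmetric,
so are `p_1(Y), …, p_d(Y)`. [folklore] -/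
theorem moments_invariant_of_esymm_invariant {m : ℕ} (v : Fin m → MvPolynomial (Fin n × Fin n) ℂ) {d : ℕ}
    (hes : ∀ j : ℕ, 1 ≤ j → j ≤ d → ∀ σ τ : Perm (Fin n),
      rename (fun q : Fin n × Fin n => (σ q.1, τ q.2)) (((univ : Finset (Fin m)).val.map v).esymm j) =
        ((univ : Finset (Fin m)).val.map v).esymm j) :
    ∀ j : ℕ, 1 ≤ j → j ≤ d → ∀ σ τ : Perm (Fin n),
      rename (fun q : Fin n × Fin n => (σ q.1, τ q.2)) (∑ i, v i ^ j) = ∑ i, v i ^ j := by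
  intro j _ hjd σ τ
  refine eq_of_mem_adjoin_of_forall_eq (rename fun q : Fin n × Fin n => (σ q.1, τ q.2)) ?_
    (moment_mem_adjoin_esymm v hjd)
  rintro t ⟨i, rfl⟩
  exact hes ((i : ℕ) + 1) (by omega) (Nat.succ_le_of_lt i.isLt) σ τ

/-- ★ **TRUNCATED-STABLE FRAMES RESTORE (unconditionally, uniform constant).**  For every `c` there is `c'` such that
at every level `n`, for every affine frame `Y = (ℓ_{w_i} + b_i)_{i<m}`, `m ≤ n^c + c`, whose elementary symmetric
polynomials `e_1(Y), …, e_d(Y)` are ALL matrix-symmetric — equivalently, `Π_{y ∈ Y} (1 + t y)` is invariant modulo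
`t^{d+1}` — and every `a`, the polynomial `a · e_d(Y)` is `QPOrbitRestorable c' n`.  Matrix-stable frames are the case
`t^∞`. [folklore; cite: Shpilka2002, Thm 3.1] -/
theorem qpOrbitRestorable_esymm_of_invariantTruncation (c : ℕ) : ∃ c' : ℕ, ∀ (n m : ℕ)
    (w : Fin m → (Fin n × Fin n) → ℂ) (b : Fin m → ℂ) (a : ℂ) (d : ℕ), m ≤ n ^ c + c →
    (∀ j : ℕ, 1 ≤ j → j ≤ d → ∀ σ τ : Perm (Fin n),
      rename (fun q : Fin n × Fin n => (σ q.1, τ q.2))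
          ((((univ : Finset (Fin m)).val.map fun i => lin (w i) + C (b i)).esymm j)) =
        ((univ : Finset (Fin m)).val.map fun i => lin (w i) + C (b i)).esymm j) →
    QPOrbitRestorable c' n
      (C a * (((univ : Finset (Fin m)).val.map fun i => lin (w i) + C (b i)).esymm d)) := by
  obtain ⟨c', hc'⟩ := qpOrbitRestorable_esymm_of_invariantMoments c
  refine ⟨c', fun n m w b a d hm hes => hc' n m w b a d hm ?_⟩
  exact moments_invariant_of_esymm_invariant (fun i => lin (w i) + C (b i)) hes

end SymmetricModel

end OrbitRestorationQPDepthThreeRung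

end Summit.ValiantsHypothesis.ValiantsHypothesis.Theorems

end
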